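import Literature.GroupTheory.Coxeter.ClassicalWeylGroupsPoincarePolynomials
import Literature.GroupTheory.Coxeter.SignedPermutationsLongestElement
import Literature.GroupTheory.Coxeter.SymmetricGroupInversions
import Literature.GroupTheory.Coxeter.DihedralPoincarePolynomial
import Literature.GroupTheory.Coxeter.EvenSubgroupBranchGenerators
import HarnessLib

/-!
# Humphreys' Table 2 for abstract Coxeter systems: `|W|`, the number of reflections `|T| = |Φ⁺| = ℓ(w₀)`, for the types `A_n`, `B_n`, `D_n`, `I₂(m)`, `G₂`
# (Humphreys, *Reflection Groups and Coxeter Groups* (1990), §2.11 Table 2; Björner–Brenti 2005, Appendix A1 Table I)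

Layer `Literature/GroupTheory/Coxeter`, namespace `Literature.GroupTheory.Coxeter`; lane `lit-hodgefound` (Track 2 foundations;
prover seat p18, gen 52, row g52-#6). The tree proves the orders, reflection counts and top lengths for its concrete MODELS (`S_{n+1}`,
`S^B_n`, `S^D_n`) and for rank two; this file transports them to EVERY Coxeter system with the same Coxeter matrix
(`ClassicalWeylGroupsPoincarePolynomials`: two Coxeter systems with the same matrix differ by transport of structure), so that the entries
of Humphreys' Table 2 become available for an arbitrary `cs : CoxeterSystem (CoxeterMatrix.A n) W`, `… (CoxeterMatrix.B n) W`,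
`… (coxeterMatrixD n) W`, `… (CoxeterMatrix.I m) W`, `… CoxeterMatrix.G₂ W`:

* §0 transport: the number of reflections and the length of the longest element depend only on the Coxeter matrix
  (`natCard_isReflection_eq_of_coxeterMatrix`, `length_top_eq_natCard_isReflection`).
* §1 `A_n`: `|W| = (n+1)!`, `|T| = n(n+1)/2 = ℓ(w₀)` (`|Φ| = n(n+1)`).
* §2 `B_n` (`n ≥ 2`): `|W| = 2ⁿ·n!`, `|T| = n² = ℓ(w₀)` (`|Φ| = 2n²`).
* §3 `D_n` (`n ≥ 2`): `|W| = 2ⁿ⁻¹·n!`, `|T| = n² − n = ℓ(w₀)` (`|Φ| = 2n(n−1)`).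
* §4 `I₂(q)` (`q = m + 2`): `|T| = q = ℓ(w₀)` (`|W| = 2q` is `natCard_typeI`); `G₂`: `|W| = 12`, `|T| = 6 = ℓ(w₀)`.

Theorems only (no definition, no named fact, no `sorry`: net debt 0); no instance, no notation. NOT here: the columns `E₆`, `E₇`, `E₈`, `F₄` of
Table 2 (and `H₃`, `H₄`), for which the tree has no model yet.

## Sources, verbatim

* J. E. Humphreys, *Reflection Groups and Coxeter Groups* (1990) [Humphreys1990] (held, chunk p0050 = book p. 44), §2.11, Table 2 «`|W|` and
  `|Φ|` for Weyl groups»: `A_n`: `(n+1)!`, `n(n+1)`; `B_n/C_n`: `2ⁿ n!`, `2n²`; `D_n`: `2ⁿ⁻¹ n!`, `2n(n−1)`; `E₆`: `2⁷3⁴5`, `72`; `E₇`: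
  `2¹⁰3⁴5·7`, `126`; `E₈`: `2¹⁴3⁵5²7`, `240`; `F₄`: `2⁷3²`, `48`; `G₂`: `12`, `12`. §1.8/§5.6 Exercise 2: `ℓ(w₀) = |Φ⁺|`.
* A. Björner, F. Brenti, *Combinatorics of Coxeter Groups* (2005) [BjornerBrenti2005], Appendix A1 Table I (orders and `|T|` of the finite
  irreducible Coxeter systems; `I₂(m)`: `2m`, `m`); §2.3 Proposition 2.3.2 (iv) («`ℓ(w₀) = |T|`»); §8.1 Proposition 8.1.5 («`S^B_n` has `n²`
  reflections»), §8.2 Proposition 8.2.5.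

## Proof notes

`e = cs₁.mulEquiv ≫ cs₂.mulEquiv⁻¹` maps `s_i ↦ s_i`, hence reflections to reflections and `w₀` to `w₀`; `|T| = ℓ(w₀)` (tree, `LongestElement`)
makes the top length a function of `|T|`. The model values: `S_{n+1}` (`natCard_isReflection_perm`), `S^B_n` (`natCard_isReflection_hyperoctahedral`,
`natCard_signedPermGroup`), `S^D_n` (`natCard_isReflection_evenSignedPermCoxeterSystem`, `natCard_evenSignedPermGroup`), rank two
(`natCard_of_rank_two`, `length_le_of_rank_two`, `exists_unique_length_eq_top_of_rank_two`).
-/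

namespace Literature.GroupTheory.Coxeter

open CoxeterSystem Equiv

/-! ### §0 Transport: `|T|` and `ℓ(w₀)` depend only on the Coxeter matrix -/

section Transport

variable {B : Type*} {M : CoxeterMatrix B} {W H : Type*} [Group W] [Group H]

/-- ★ **The number of reflections depends only on the Coxeter matrix.** [cite: BjornerBrenti2005, §1.1 p. 2 («isomorphism of Coxeter systems»)]
[cite: Humphreys1990, §5.7] -/
theorem natCard_isReflection_eq_of_coxeterMatrix (cs₁ : CoxeterSystem M W) (cs₂ : CoxeterSystem M H) :
    Nat.card {t // cs₂.IsReflection t} = Nat.card {t // cs₁.IsReflection t} := by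
  rw [← natCard_isReflection_map cs₁ (cs₁.mulEquiv.trans cs₂.mulEquiv.symm), map_mulEquiv_trans_mulEquiv_symm]

variable [Fintype B] [DecidableEq B]

/-- **`ℓ(w₀) = |T|`** for any element `w₀` having every simple reflection as a left descent — so the top length, too, depends only on the
Coxeter matrix. [cite: BjornerBrenti2005, §2.3 Proposition 2.3.2 (iv) («`ℓ(w₀) = |T|`»)] [cite: Humphreys1990, §1.8, §5.6 Exercise 2] -/
theorem length_top_eq_natCard_isReflection (cs : CoxeterSystem M W) {w₀ : W} (hw₀ : ∀ i, cs.IsLeftDescent w₀ i) :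
    cs.length w₀ = Nat.card {t // cs.IsReflection t} :=
  (natCard_isReflection_of_forall_isLeftDescent hw₀).symm

/-- The top lengths of two Coxeter systems with the same matrix agree. [cite: BjornerBrenti2005, §2.3 Proposition 2.3.2 (iv)] -/
theorem length_top_eq_of_coxeterMatrix (cs₁ : CoxeterSystem M W) (cs₂ : CoxeterSystem M H) {w₁ : W} (hw₁ : ∀ i, cs₁.IsLeftDescent w₁ i)
    {w₂ : H} (hw₂ : ∀ i, cs₂.IsLeftDescent w₂ i) : cs₂.length w₂ = cs₁.length w₁ := by
  rw [length_top_eq_natCard_isReflection cs₁ hw₁, length_top_eq_natCard_isReflection cs₂ hw₂, natCard_isReflection_eq_of_coxeterMatrix cs₁ cs₂]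

end Transport

/-! ### §1 Type `A_n`: `|W| = (n+1)!`, `|T| = n(n+1)/2` -/

section TypeA

variable {n : ℕ} {W : Type*} [Group W]

/-- ★ **Table 2, `A_n`: `|W| = (n+1)!`.** [cite: Humphreys1990, §2.11 Table 2 p. 44] [cite: BjornerBrenti2005, Appendix A1 Table I] -/
theorem natCard_typeA (cs : CoxeterSystem (CoxeterMatrix.A n) W) : Nat.card W = (n + 1).factorial := by
  rw [natCard_eq_of_coxeterMatrix (symmetricGroupCoxeterSystem n) cs, Nat.card_eq_fintype_card, Fintype.card_perm, Fintype.card_fin]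

/-- ★ **Table 2, `A_n`: `|T| = |Φ⁺| = n(n+1)/2`** (the transpositions of `S_{n+1}`). [cite: Humphreys1990, §2.11 Table 2 p. 44 (`|Φ| = n(n+1)`)]
[cite: BjornerBrenti2005, Appendix A1 Table I] -/
theorem natCard_isReflection_typeA (cs : CoxeterSystem (CoxeterMatrix.A n) W) : Nat.card {t // cs.IsReflection t} = (n + 1) * n / 2 := by
  rw [natCard_isReflection_eq_of_coxeterMatrix (symmetricGroupCoxeterSystem n) cs, natCard_isReflection_perm]

/-- `A_n`: `|Φ| = 2|T| = n(n+1)`. [cite: Humphreys1990, §2.11 Table 2 p. 44] -/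
theorem two_mul_natCard_isReflection_typeA (cs : CoxeterSystem (CoxeterMatrix.A n) W) : 2 * Nat.card {t // cs.IsReflection t} = n * (n + 1) := by
  rw [natCard_isReflection_typeA cs]
  have h : 2 ∣ (n + 1) * n := by rw [mul_comm]; exact (Nat.even_mul_succ_self n).two_dvd
  rw [Nat.mul_div_cancel' h, mul_comm]

/-- `A_n`: `ℓ(w₀) = n(n+1)/2` for the longest element `w₀` (any element with every `s_i` as a descent). [cite: BjornerBrenti2005, §2.3 Proposition 2.3.2
(iv), Appendix A1 Table I] -/
theorem length_top_typeA (cs : CoxeterSystem (CoxeterMatrix.A n) W) {w₀ : W} (hw₀ : ∀ i, cs.IsLeftDescent w₀ i) :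
    cs.length w₀ = (n + 1) * n / 2 := by
  rw [length_top_eq_natCard_isReflection cs hw₀, natCard_isReflection_typeA cs]

end TypeA

/-! ### §2 Type `B_n`: `|W| = 2ⁿ·n!`, `|T| = n²` -/

section TypeB

variable {n : ℕ} {W : Type*} [Group W]

/-- ★ **Table 2, `B_n/C_n`: `|W| = 2ⁿ·n!`** (`n ≥ 2`). [cite: Humphreys1990, §2.11 Table 2 p. 44] [cite: BjornerBrenti2005, Appendix A1 Table I] -/
theorem natCard_typeB (hn : 2 ≤ n) (cs : CoxeterSystem (CoxeterMatrix.B n) W) : Nat.card W = 2 ^ n * n.factorial := by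
  rw [natCard_eq_of_coxeterMatrix (hyperoctahedralCoxeterSystem n hn) cs, natCard_signedPermGroup]

/-- ★ **Table 2, `B_n/C_n`: `|T| = |Φ⁺| = n²`** (`n ≥ 2`). [cite: Humphreys1990, §2.11 Table 2 p. 44 (`|Φ| = 2n²`)] [cite: BjornerBrenti2005, §8.1 Proposition
8.1.5 («`S^B_n` has `n²` reflections»)] -/
theorem natCard_isReflection_typeB (hn : 2 ≤ n) (cs : CoxeterSystem (CoxeterMatrix.B n) W) : Nat.card {t // cs.IsReflection t} = n ^ 2 := by
  rw [natCard_isReflection_eq_of_coxeterMatrix (hyperoctahedralCoxeterSystem n hn) cs, natCard_isReflection_hyperoctahedral hn]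

/-- `B_n`: `ℓ(w₀) = n²`. [cite: BjornerBrenti2005, §2.3 Proposition 2.3.2 (iv), §8.1 (8.1) p. 245, Appendix A1 Table I] -/
theorem length_top_typeB (hn : 2 ≤ n) (cs : CoxeterSystem (CoxeterMatrix.B n) W) {w₀ : W} (hw₀ : ∀ i, cs.IsLeftDescent w₀ i) :
    cs.length w₀ = n ^ 2 := by
  rw [length_top_eq_natCard_isReflection cs hw₀, natCard_isReflection_typeB hn cs]

/-- `B_n`: `W` is finite of even order `2·(2ⁿ⁻¹ n!)`, so a longest element exists. [cite: Humphreys1990, §2.11 Table 2 p. 44; §1.8] -/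
theorem exists_top_typeB (hn : 2 ≤ n) (cs : CoxeterSystem (CoxeterMatrix.B n) W) : ∃ w₀ : W, (∀ i, cs.IsLeftDescent w₀ i) ∧ cs.length w₀ = n ^ 2 := by
  haveI := finite_of_type_B cs
  obtain ⟨w₀, hw₀⟩ := exists_forall_isLeftDescent cs
  exact ⟨w₀, hw₀, length_top_typeB hn cs hw₀⟩

end TypeB

/-! ### §3 Type `D_n`: `|W| = 2ⁿ⁻¹·n!`, `|T| = n² − n` -/

section TypeD

variable {n : ℕ} {W : Type*} [Group W]

/-- ★ **Table 2, `D_n`: `|W| = 2ⁿ⁻¹·n!`** (`n ≥ 2`; the tree's `coxeterMatrixD n`, `D₂ = A₁ × A₁`, `D₃ = A₃`). [cite: Humphreys1990, §2.11 Table 2 p. 44]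
[cite: BjornerBrenti2005, Appendix A1 Table I] -/
theorem natCard_typeD (hn : 2 ≤ n) (cs : CoxeterSystem (coxeterMatrixD n) W) : Nat.card W = 2 ^ (n - 1) * n.factorial := by
  rw [natCard_eq_of_coxeterMatrix (evenSignedPermCoxeterSystem n hn) cs, natCard_evenSignedPermGroup hn]

/-- ★ **Table 2, `D_n`: `|T| = |Φ⁺| = n² − n`** (`n ≥ 2`). [cite: Humphreys1990, §2.11 Table 2 p. 44 (`|Φ| = 2n(n−1)`)] [cite: BjornerBrenti2005, §8.2
Proposition 8.2.5] -/
theorem natCard_isReflection_typeD (hn : 2 ≤ n) (cs : CoxeterSystem (coxeterMatrixD n) W) : Nat.card {t // cs.IsReflection t} = n ^ 2 - n := by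
  rw [natCard_isReflection_eq_of_coxeterMatrix (evenSignedPermCoxeterSystem n hn) cs, natCard_isReflection_evenSignedPermCoxeterSystem hn]

/-- `D_n`: `|T| = n(n−1)`. [cite: Humphreys1990, §2.11 Table 2 p. 44] -/
theorem natCard_isReflection_typeD' (hn : 2 ≤ n) (cs : CoxeterSystem (coxeterMatrixD n) W) : Nat.card {t // cs.IsReflection t} = n * (n - 1) := by
  rw [natCard_isReflection_typeD hn cs]
  obtain ⟨k, rfl⟩ : ∃ k, n = k + 1 := ⟨n - 1, by omega⟩
  simp only [add_tsub_cancel_right]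
  rw [show (k + 1) ^ 2 = (k + 1) * k + (k + 1) by ring, Nat.add_sub_cancel]

/-- `D_n`: `ℓ(w₀) = n² − n`. [cite: BjornerBrenti2005, §2.3 Proposition 2.3.2 (iv), §8.2 (8.18) p. 250, Appendix A1 Table I] -/
theorem length_top_typeD (hn : 2 ≤ n) (cs : CoxeterSystem (coxeterMatrixD n) W) {w₀ : W} (hw₀ : ∀ i, cs.IsLeftDescent w₀ i) :
    cs.length w₀ = n ^ 2 - n := by
  rw [length_top_eq_natCard_isReflection cs hw₀, natCard_isReflection_typeD hn cs]

/-- `D_n`: a longest element exists, of length `n² − n`. [cite: Humphreys1990, §2.11 Table 2; §1.8] -/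
theorem exists_top_typeD (hn : 2 ≤ n) (cs : CoxeterSystem (coxeterMatrixD n) W) :
    ∃ w₀ : W, (∀ i, cs.IsLeftDescent w₀ i) ∧ cs.length w₀ = n ^ 2 - n := by
  haveI := finite_of_type_D cs
  obtain ⟨w₀, hw₀⟩ := exists_forall_isLeftDescent cs
  exact ⟨w₀, hw₀, length_top_typeD hn cs hw₀⟩

/-- `[B_n : D_n]`-type comparison of orders: `|W(B_n)| = 2·|W(D_n)|` for any Coxeter systems of these types. [cite: BjornerBrenti2005, §8.2 p. 250
(«subgroup of index 2»), Appendix A1 Table I] -/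
theorem natCard_typeB_eq_two_mul_natCard_typeD (hn : 2 ≤ n) {W' : Type*} [Group W'] (cs : CoxeterSystem (CoxeterMatrix.B n) W)
    (cs' : CoxeterSystem (coxeterMatrixD n) W') : Nat.card W = 2 * Nat.card W' := by
  rw [natCard_typeB hn cs, natCard_typeD hn cs']
  obtain ⟨k, rfl⟩ : ∃ k, n = k + 1 := ⟨n - 1, by omega⟩
  simp only [add_tsub_cancel_right, pow_succ]
  ring

end TypeD

/-! ### §4 Rank two: `I₂(q)` and `G₂` -/

section RankTwo

variable {m : ℕ} {W : Type*} [Group W]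

/-- `Fin 2 = {0, 1}`. [folklore] -/
private theorem fin_two_eq_or (k : Fin 2) : k = 0 ∨ k = 1 := by
  fin_cases k
  · exact Or.inl rfl
  · exact Or.inr rfl

/-- ★ **`I₂(q)`, `q = m + 2`: the longest element has length `q`** (every element has length `≤ q`, and one has length `q`). [cite: BjornerBrenti2005,
Appendix A1 Table I (`I₂(m)`: `|T| = m`), §2.3 Proposition 2.3.2 (iv)] [cite: Humphreys1990, §1.8] -/
theorem length_top_typeI (cs : CoxeterSystem (CoxeterMatrix.I m) W) {w₀ : W} (hw₀ : ∀ i, cs.IsLeftDescent w₀ i) : cs.length w₀ = m + 2 := by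
  have h01 : (0 : Fin 2) ≠ 1 := by decide
  have hM : CoxeterMatrix.I m 0 1 = m + 2 := by rw [coxeterMatrixI_apply, if_neg h01]
  have hm : CoxeterMatrix.I m 0 1 ≠ 0 := by rw [hM]; omega
  refine le_antisymm (hM ▸ length_le_of_rank_two cs fin_two_eq_or h01 hm w₀) ?_
  obtain ⟨w, hw, -⟩ := exists_unique_length_eq_top_of_rank_two cs fin_two_eq_or h01
  rw [← hM, ← hw]
  exact length_le_of_forall_isLeftDescent hw₀ w

/-- ★ **Table I, `I₂(q)`: `|T| = q`** — the dihedral group of order `2q` has `q` reflections. [cite: BjornerBrenti2005, Appendix A1 Table I (`I₂(m)`: `T`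
`m`)] [cite: Humphreys1990, §1.1 («`𝒟_m` contains `m` rotations … and `m` reflections»)] -/
theorem natCard_isReflection_typeI (cs : CoxeterSystem (CoxeterMatrix.I m) W) : Nat.card {t // cs.IsReflection t} = m + 2 := by
  haveI := finite_typeI cs
  obtain ⟨w₀, hw₀⟩ := exists_forall_isLeftDescent cs
  rw [← length_top_eq_natCard_isReflection cs hw₀, length_top_typeI cs hw₀]

/-- `I₂(q)`: `|W| = 2|T|`. [cite: Humphreys1990, §1.1] [cite: BjornerBrenti2005, Appendix A1 Table I] -/
theorem natCard_eq_two_mul_natCard_isReflection_typeI (cs : CoxeterSystem (CoxeterMatrix.I m) W) :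
    Nat.card W = 2 * Nat.card {t // cs.IsReflection t} := by
  rw [natCard_isReflection_typeI cs, natCard_typeI cs]

/-- ★ **Table 2, `G₂`: `|W| = 12`** (Mathlib's `CoxeterMatrix.G₂`). [cite: Humphreys1990, §2.11 Table 2 p. 44] -/
theorem natCard_G₂ (cs : CoxeterSystem CoxeterMatrix.G₂ W) : Nat.card W = 12 := by
  have h : CoxeterMatrix.G₂ 0 1 = 6 := by decide
  rw [natCard_of_rank_two cs fin_two_eq_or (by decide) (by rw [h]; decide), h]

/-- ★ **Table 2, `G₂`: `|T| = |Φ⁺| = 6`** (`|Φ| = 12`) and `ℓ(w₀) = 6`. [cite: Humphreys1990, §2.11 Table 2 p. 44] -/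
theorem natCard_isReflection_G₂ (cs : CoxeterSystem CoxeterMatrix.G₂ W) :
    Nat.card {t // cs.IsReflection t} = 6 ∧ ∀ w₀ : W, (∀ i, cs.IsLeftDescent w₀ i) → cs.length w₀ = 6 := by
  have h01 : (0 : Fin 2) ≠ 1 := by decide
  have hM : CoxeterMatrix.G₂ 0 1 = 6 := by decide
  have htop : ∀ w₀ : W, (∀ i, cs.IsLeftDescent w₀ i) → cs.length w₀ = 6 := fun w₀ hw₀ ↦ by
    refine le_antisymm (hM ▸ length_le_of_rank_two cs fin_two_eq_or h01 (by rw [hM]; decide) w₀) ?_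
    obtain ⟨w, hw, -⟩ := exists_unique_length_eq_top_of_rank_two cs fin_two_eq_or h01
    rw [← hM, ← hw]
    exact length_le_of_forall_isLeftDescent hw₀ w
  refine ⟨?_, htop⟩
  haveI : Finite W := finite_of_rank_two cs fin_two_eq_or h01 (by rw [hM]; decide)
  obtain ⟨w₀, hw₀⟩ := exists_forall_isLeftDescent cs
  rw [← length_top_eq_natCard_isReflection cs hw₀, htop w₀ hw₀]

end RankTwo

end Literature.GroupTheory.Coxeter
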